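import Mathlib
import Literature.Analysis.FluidPDE.SpaceTimeRescaling
import Literature.Analysis.FluidPDE.TypeIAncientMildRssPullback
import Literature.Analysis.FluidPDE.Seregin2020SingularSetAxis
import Summits.NavierStokesRegularity.NavierStokesRegularity.Theorems.EulerZoomLiouvillePowerGaugeEulerLiouvilleSelfSimilarPressureSlavingPastCovariance
import Summits.NavierStokesRegularity.NavierStokesRegularity.Theorems.EulerZoomLiouvillePowerGaugeEulerLiouvilleSelfSimilarPressureSlavingPastProfile
import Summits.NavierStokesRegularity.NavierStokesRegularity.Theorems.EulerZoomLiouvillePowerGaugeEulerLiouvilleKillingRotation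
import Summits.NavierStokesRegularity.NavierStokesRegularity.Theorems.RellichScarSimilarityCovarianceRotationWeak
import HarnessLib

/-!
# Crux `EulerZoomLiouville.PowerGaugeEulerLiouville` (stmt-NavierStokesRegularity-19832), line `relative_equilibria` (ns-idea-11), R3a PORT RECIPE
# brick P4 (slaving half), file 1: SPIRAL PRESSURE SLAVING — centring, KEY ALGEBRA (ii), rotated one-sided covariance, fibrewise rotations

Route №10 `EulerZoomLiouville` (NavierStokesRegularity), crux E; width seat ns-sfl-p1 g11 under the LEAD ns-typeII-p2 (R3a recipe of
`Cruxes/PowerGaugeEulerLiouville/Lines/relative-equilibria.md`, brick P4 = spiral twin of `PressureSlaving.inClass_pastSelfSimilarPressure`).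

SPIRAL (rotated self-similar, Perelman-ansatz) velocity about `(T, x₀)` with skew generator `S` (`⟪Sx, y⟫ = −⟪x, Sy⟫`) and profile `V` on the
past sub-slab `τ < T₁` (`T₁ ≤ 0`, `T₁ ≤ T`): `u(τ, x) = λ^{γ−1} e^{(log λ)S} V(e^{−(log λ)S} λ^{−γ}(x − x₀))`, `λ = T − τ` (the line's
`IsPastSpiral ρ T T₁ x₀ S u V` with `γ = 1/(2+ρ)` and `twist S s = NormedSpace.exp (s • S)` written out).  The tools of the untwisted lane
(`PressureSlaving.*`, `…SelfSimilarPressureSlavingPastCovariance`) port as follows: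

* `Spiral.shift_spiral` — CENTRING: the shifted velocity `w = stPull 1 1 T x₀ u` is spiral about the ORIGIN on the window `s < S₁ := T₁ − T`;
* `Spiral.spiral_smul_stPull_apply_of_lt` — KEY ALGEBRA (ii): for `β ≥ 1` the Euler rescaling `β^{1−γ} w(β s, β^{γ} y)` of a spiral velocity is
  its CONJUGATE `R_β w(s, R_β⁻¹ y)` by the FIXED rotation `R_β = e^{(log β)S}` on the window (group law `e^{(a+b)S} = e^{aS} e^{bS}`);
* `Spiral.isDistributional_rescaledRotatedPressure_top` — ROTATED ONE-SIDED COVARIANCE: if `(w, q)` is a distributional Euler pair on the window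
  slab and `w` is spiral about the origin there, then for every `β ≥ 1` the pair `(w, q̃_β)`, `q̃_β(s, y) = β^{2(1−γ)} q(β s, β^{γ} R_β y)`, is again
  a distributional Euler pair on the window slab with the SAME velocity (rescaling covariance `IsDistributionalNSSolutionOn.stRescale`, then the
  rotation covariance `RellichScarSimilarityCovariance.isDistributionalNSSolutionOn_conj` with `R_β⁻¹`, then `congr_ae` on the window);
* `Spiral.setLIntegral_parabolicCylinder_comp_rot` — origin-centred parabolic cylinders are invariant under `(s, y) ↦ (s, R y)`;
* `Spiral.measurable_uncurry_expSkew_apply`, `Spiral.measurePreserving_fibreRot` — the FIBREWISE ROTATION `(s, y) ↦ (s, e^{c(s) S} y)` (`c`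
  measurable) preserves `μ_T ⊗ Lebesgue` (Mathlib's `MeasurePreserving.skew_product` over `Killing.measurePreserving_expSkew`).

WHAT THIS IS NOT: not NS, not E, not a stub: bookkeeping for one brick (P4) of the port R3a of a width sub-line (spiral = `O(3)`-twisted
self-similar stratum of `stub_nonSelfSimilarRest`); 19832 OPEN; no summit statement is proved by this file.
[folklore; ChaeTsai2013DSS p. 4 (Perelman's rotated ansatz); CaffarelliKohnNirenberg1982 §2 (scaling covariance); MajdaBertozzi2002 §1.2 Prop. 1.1 (iii)]
-/

noncomputable section

-- flat `Theorems/<Route><Decl>…` files of one crux share the namespace of the crux (tree convention: `Summit.<S>.<S>.…`)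
set_option linter.dupNamespace false

open MeasureTheory Set Filter Topology Metric Function TopologicalSpace
open scoped ENNReal NNReal RealInnerProductSpace

namespace Summit.NavierStokesRegularity.NavierStokesRegularity.Theorems.PowerGaugeEulerLiouville

open Literature.Analysis Literature.Analysis.FunctionSpaces Literature.Analysis.FluidPDE

namespace Spiral

variable {S : EuclideanSpace ℝ (Fin 3) →L[ℝ] EuclideanSpace ℝ (Fin 3)}

/-! ### Centring at `(T, x₀)` -/

/-- **CENTRING.**  The shifted velocity `w(s, y) = u(T + s, x₀ + y)` of a spiral member about `(T, x₀)` on `τ < T₁` is spiral about the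
ORIGIN on the window `s < T₁ − T`: `w(s, y) = (−s)^{γ−1} e^{(log(−s))S} V(e^{−(log(−s))S} (−s)^{−γ} y)`. [folklore; ChaeTsai2013DSS p. 4] -/
theorem shift_spiral {γ T T₁ : ℝ} {x₀ : EuclideanSpace ℝ (Fin 3)}
    {u : ℝ → EuclideanSpace ℝ (Fin 3) → EuclideanSpace ℝ (Fin 3)} {V : EuclideanSpace ℝ (Fin 3) → EuclideanSpace ℝ (Fin 3)}
    (hu : ∀ τ : ℝ, τ < T₁ → u τ = fun x => (T - τ) ^ (γ - 1) •
      NormedSpace.exp ((Real.log (T - τ)) • S) (V (NormedSpace.exp ((-Real.log (T - τ)) • S) ((T - τ) ^ (-γ) • (x - x₀))))) :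
    ∀ s : ℝ, s < T₁ - T → stPull 1 1 T x₀ u s = fun y => (-s) ^ (γ - 1) •
      NormedSpace.exp ((Real.log (-s)) • S) (V (NormedSpace.exp ((-Real.log (-s)) • S) ((-s) ^ (-γ) • y))) := by
  intro s hs
  funext y
  rw [stPull_apply, one_mul, one_smul, hu (T + s) (by linarith)]
  simp only [add_sub_cancel_left, show T - (T + s) = -s by ring]

/-! ### KEY ALGEBRA (ii): the Euler rescaling of a spiral velocity is a fixed rotation conjugate -/

/-- **KEY ALGEBRA (ii).**  If `w` is spiral about the origin on the window `s < S₁ ≤ 0` then for `β ≥ 1` and `s < S₁`: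
`β^{1−γ} w(β s, β^{γ} y) = e^{(log β)S} w(s, e^{−(log β)S} y)` — the rescaled field is the conjugate of `w` by the fixed rotation
`R_β = e^{(log β)S}`, because `e^{(log(β λ))S} = e^{(log β)S} e^{(log λ)S}` and `R_β` commutes with the dilations. [folklore; ChaeTsai2013DSS p. 4] -/
theorem spiral_smul_stPull_apply_of_lt {γ β S₁ : ℝ} (hβ1 : 1 ≤ β) (hS₁ : S₁ ≤ 0)
    {w : ℝ → EuclideanSpace ℝ (Fin 3) → EuclideanSpace ℝ (Fin 3)} {V : EuclideanSpace ℝ (Fin 3) → EuclideanSpace ℝ (Fin 3)}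
    (hw : ∀ s : ℝ, s < S₁ → w s = fun y => (-s) ^ (γ - 1) •
      NormedSpace.exp ((Real.log (-s)) • S) (V (NormedSpace.exp ((-Real.log (-s)) • S) ((-s) ^ (-γ) • y))))
    {s : ℝ} (hs : s < S₁) (y : EuclideanSpace ℝ (Fin 3)) :
    (β ^ (1 - γ) • stPull β (β ^ γ) 0 (0 : EuclideanSpace ℝ (Fin 3)) w) s y =
      NormedSpace.exp ((Real.log β) • S) (w s (NormedSpace.exp ((-Real.log β) • S) y)) := by
  have hβ : 0 < β := one_pos.trans_le hβ1
  have hs0 : s < 0 := hs.trans_le hS₁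
  have hns : 0 < -s := neg_pos.2 hs0
  have hβs : β * s < S₁ := by nlinarith
  rw [smul_stPull_apply, zero_add, zero_add, hw _ hβs, hw s hs]
  simp only
  have e1 : -(β * s) = β * (-s) := by ring
  rw [e1, Real.log_mul hβ.ne' hns.ne', Real.mul_rpow hβ.le hns.le, Real.mul_rpow hβ.le hns.le,
    rss_exp_add_smul S (Real.log β) (Real.log (-s)),
    show -(Real.log β + Real.log (-s)) = (-Real.log (-s)) + (-Real.log β) by ring,
    rss_exp_add_smul S (-Real.log (-s)) (-Real.log β)]
  simp only [mul_apply_eq_comp, map_smul, smul_smul]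
  have e2 : β ^ (1 - γ) * (β ^ (γ - 1) * (-s) ^ (γ - 1)) = (-s) ^ (γ - 1) := by
    rw [← mul_assoc, ← Real.rpow_add hβ, show (1 - γ) + (γ - 1) = 0 by ring, Real.rpow_zero, one_mul]
  have e3 : β ^ (-γ) * (-s) ^ (-γ) * β ^ γ = (-s) ^ (-γ) := by
    rw [mul_comm, ← mul_assoc, ← Real.rpow_add hβ, show γ + -γ = 0 by ring, Real.rpow_zero, one_mul]
  rw [e2, e3]

/-! ### Rotated one-sided covariance on the window slab -/

/-- **ROTATED ONE-SIDED COVARIANCE.**  Let `(w, q)` be a distributional Euler pair (no force) on the window slab `(−∞, S₁) × ℝ³`, `S₁ ≤ 0`,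
with `w` spiral about the origin there (skew `S`).  Then for every `β ≥ 1` the pair `(w, q̃_β)`,
`q̃_β(s, y) = β^{2(1−γ)} q(β s, β^{γ} e^{(log β)S} y)`, is a distributional Euler pair on the window slab with the SAME velocity:
rescale by `(β^{1−γ}, β, β^{γ})` (`IsDistributionalNSSolutionOn.stRescale`; the window is mapped into itself), conjugate by the fixed
rotation `R_β⁻¹ = e^{−(log β)S}` (`isDistributionalNSSolutionOn_conj`), and note that the resulting velocity IS `w` on the window (KEY
ALGEBRA (ii)). [cite: CaffarelliKohnNirenberg1982, §2] -/
theorem isDistributional_rescaledRotatedPressure_top {γ β S₁ : ℝ} (hβ1 : 1 ≤ β) (hS₁ : S₁ ≤ 0)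
    (hS : ∀ x y : EuclideanSpace ℝ (Fin 3), ⟪S x, y⟫ = -⟪x, S y⟫)
    {w : ℝ → EuclideanSpace ℝ (Fin 3) → EuclideanSpace ℝ (Fin 3)} {q : ℝ → EuclideanSpace ℝ (Fin 3) → ℝ}
    {V : EuclideanSpace ℝ (Fin 3) → EuclideanSpace ℝ (Fin 3)}
    (hdist : IsDistributionalNSSolutionOn (slab (EuclideanSpace ℝ (Fin 3)) (Iio S₁) isOpen_Iio) 0 0 w q)
    (hw : ∀ s : ℝ, s < S₁ → w s = fun y => (-s) ^ (γ - 1) •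
      NormedSpace.exp ((Real.log (-s)) • S) (V (NormedSpace.exp ((-Real.log (-s)) • S) ((-s) ^ (-γ) • y)))) :
    IsDistributionalNSSolutionOn (slab (EuclideanSpace ℝ (Fin 3)) (Iio S₁) isOpen_Iio) 0 0 w
      (fun s y => ((β ^ (1 - γ)) ^ 2 • stPull β (β ^ γ) 0 (0 : EuclideanSpace ℝ (Fin 3)) q) s
        (NormedSpace.exp ((Real.log β) • S) y)) := by
  have hβ : 0 < β := one_pos.trans_le hβ1
  have hα : 0 < β ^ (1 - γ) := Real.rpow_pos_of_pos hβ _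
  have hγ : 0 < β ^ γ := Real.rpow_pos_of_pos hβ _
  have hβeq : β = β ^ (1 - γ) * β ^ γ := by
    rw [← Real.rpow_add hβ, show (1 - γ) + γ = 1 by ring, Real.rpow_one]
  have h := hdist.stRescale hα hγ hβeq 0 (0 : EuclideanSpace ℝ (Fin 3))
  rw [mul_zero, zero_div] at h
  have h0 : ((β ^ (1 - γ)) ^ 2 * β ^ γ) • stPull β (β ^ γ) 0 (0 : EuclideanSpace ℝ (Fin 3))
      (0 : ℝ → EuclideanSpace ℝ (Fin 3) → EuclideanSpace ℝ (Fin 3)) = 0 := by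
    funext s y
    rw [smul_stPull_apply]
    simp
  rw [h0] at h
  have h' := h.of_le (PressureSlaving.slab_le_stPreimage hβ1 hS₁ (β ^ γ))
  -- the fixed rotation `R_β⁻¹ = e^{−(log β)S}` as a linear isometry (`L = e^{−(log β)S}`, `L⁻¹ = e^{(log β)S}`)
  have hS0 : ∀ x : EuclideanSpace ℝ (Fin 3), ⟪S x, x⟫ = 0 := fun x => by
    have h := hS x x
    rw [real_inner_comm (S x) x] at h
    linarith
  obtain ⟨L, hL, hLs⟩ := rss_exists_rot hS0 (Real.log β)
  have h'' := RellichScarSimilarityCovariance.isDistributionalNSSolutionOn_conj h' L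
  have hf0 : (fun t x => L ((0 : ℝ → EuclideanSpace ℝ (Fin 3) → EuclideanSpace ℝ (Fin 3)) t (L.symm x))) = 0 := by
    funext t x
    simp
  rw [hf0] at h''
  refine h''.congr_ae ?_ ?_
  · rw [coe_slab]
    filter_upwards [ae_restrict_mem (measurableSet_Iio.prod MeasurableSet.univ)] with z hz
    simp only [uncurry]
    rw [hLs, spiral_smul_stPull_apply_of_lt hβ1 hS₁ hw (mem_prod.1 hz).1, hL,
      Killing.expSkew_neg_apply_expSkew, ← hL, ← hLs, LinearIsometryEquiv.apply_symm_apply]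
  · exact ae_of_all _ fun z => by simp only [uncurry, hLs]

/-! ### Origin-centred parabolic cylinders are rotation invariant -/

/-- Cylinder integrals are invariant under a linear isometry of the space variable: `∫∫_{Q_a(S₁,0)} F(s, R y) = ∫∫_{Q_a(S₁,0)} F`. [folklore] -/
theorem setLIntegral_parabolicCylinder_comp_rot (R : EuclideanSpace ℝ (Fin 3) ≃ₗᵢ[ℝ] EuclideanSpace ℝ (Fin 3))
    (F : ℝ × EuclideanSpace ℝ (Fin 3) → ℝ≥0∞) (a S₁ : ℝ) :
    ∫⁻ z in parabolicCylinder a (S₁, (0 : EuclideanSpace ℝ (Fin 3))), F (z.1, R z.2) =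
      ∫⁻ z in parabolicCylinder a (S₁, (0 : EuclideanSpace ℝ (Fin 3))), F z := by
  have hmp := measurePreserving_prodMap_id_linearIsometryEquiv R
  have hemb := measurableEmbedding_prodMap_id_linearIsometryEquiv R
  have h := hmp.setLIntegral_comp_preimage_emb hemb F (parabolicCylinder a (S₁, (0 : EuclideanSpace ℝ (Fin 3))))
  have hpre : Prod.map (id : ℝ → ℝ) (R : EuclideanSpace ℝ (Fin 3) → EuclideanSpace ℝ (Fin 3)) ⁻¹'
      parabolicCylinder a (S₁, (0 : EuclideanSpace ℝ (Fin 3))) = parabolicCylinder a (S₁, (0 : EuclideanSpace ℝ (Fin 3))) := by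
    ext z
    simp only [mem_preimage, mem_parabolicCylinder, Prod.map_fst, Prod.map_snd, id_eq, dist_zero_right,
      LinearIsometryEquiv.norm_map]
  rw [hpre] at h
  exact h

/-! ### Fibrewise rotations preserve the product measure -/

/-- The map `(s, y) ↦ e^{c(s) S} y` is (jointly) measurable for measurable `c`. [folklore] -/
theorem measurable_uncurry_expSkew_apply (S : EuclideanSpace ℝ (Fin 3) →L[ℝ] EuclideanSpace ℝ (Fin 3)) {c : ℝ → ℝ} (hc : Measurable c) :
    Measurable (uncurry fun (s : ℝ) (y : EuclideanSpace ℝ (Fin 3)) => NormedSpace.exp ((c s) • S) y) := by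
  have hexpm : Measurable fun r : ℝ => NormedSpace.exp (r • S) :=
    (continuous_iff_continuousAt.2 fun r => (hasDerivAt_exp_smul_const' (𝕂 := ℝ) S r).continuousAt).measurable
  have h1 : Measurable fun z : ℝ × EuclideanSpace ℝ (Fin 3) => (NormedSpace.exp ((c z.1) • S), z.2) :=
    ((hexpm.comp (hc.comp measurable_fst)).prodMk measurable_snd)
  have h2 : Continuous fun p : (EuclideanSpace ℝ (Fin 3) →L[ℝ] EuclideanSpace ℝ (Fin 3)) × EuclideanSpace ℝ (Fin 3) => p.1 p.2 :=
    isBoundedBilinearMap_apply.continuous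
  exact h2.measurable.comp h1

/-- **FIBREWISE ROTATIONS PRESERVE THE PRODUCT MEASURE.**  For skew `S` (`⟪Sx, x⟫ = 0`), measurable `c : ℝ → ℝ` and any s-finite time
measure `μ_T`, the skew product `(s, y) ↦ (s, e^{c(s)S} y)` preserves `μ_T ⊗ Lebesgue` (each fibre map is a rotation,
`Killing.measurePreserving_expSkew`; Mathlib's `MeasurePreserving.skew_product`). [folklore] -/
theorem measurePreserving_fibreRot (hS0 : ∀ x : EuclideanSpace ℝ (Fin 3), ⟪S x, x⟫ = 0) {c : ℝ → ℝ} (hc : Measurable c)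
    (μT : Measure ℝ) [SFinite μT] :
    MeasurePreserving (fun z : ℝ × EuclideanSpace ℝ (Fin 3) => (z.1, NormedSpace.exp ((c z.1) • S) z.2))
      (μT.prod (volume : Measure (EuclideanSpace ℝ (Fin 3)))) (μT.prod (volume : Measure (EuclideanSpace ℝ (Fin 3)))) :=
  (MeasurePreserving.id μT).skew_product (g := fun s y => NormedSpace.exp ((c s) • S) y)
    (measurable_uncurry_expSkew_apply S hc) (Eventually.of_forall fun s => (Killing.measurePreserving_expSkew hS0 (c s)).map_eq)

/-- Lebesgue measure restricted to the slab below `S₁` is preserved by the fibrewise rotation `(s, y) ↦ (s, e^{c(s)S} y)`. [folklore] -/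
theorem measurePreserving_fibreRot_slab (hS0 : ∀ x : EuclideanSpace ℝ (Fin 3), ⟪S x, x⟫ = 0) {c : ℝ → ℝ} (hc : Measurable c)
    (S₁ : ℝ) :
    MeasurePreserving (fun z : ℝ × EuclideanSpace ℝ (Fin 3) => (z.1, NormedSpace.exp ((c z.1) • S) z.2))
      (volume.restrict (Iio S₁ ×ˢ (univ : Set (EuclideanSpace ℝ (Fin 3)))))
      (volume.restrict (Iio S₁ ×ˢ (univ : Set (EuclideanSpace ℝ (Fin 3))))) := by
  rw [PressureSlaving.volume_restrict_slab_eq_prod_top]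
  exact measurePreserving_fibreRot hS0 hc _

end Spiral

end Summit.NavierStokesRegularity.NavierStokesRegularity.Theorems.PowerGaugeEulerLiouville

end
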